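import Literature.NumberTheory.Automorphic.GL2CCoeffRepComplex
import Literature.NumberTheory.Automorphic.GL2CUpperHalfSpaceCalculus
import Literature.NumberTheory.DiophantineGeometry.SchurWeylPlethysmPolynomialProofs
import HarnessLib

/-!
# Smoothness of `M ↦ E(M) v` on `GL₂(ℂ) ⊆ M₂(ℂ)` for the coefficient module `E_λ(ℂ)`

`coeffRepC K λ : GL₂(ℂ) → GL(E_λ(ℂ))` (`GL2CCoeffRepComplex`) is an ALGEBRAIC representation: on the
factor at `σ₀` it is `V_{λ_{σ₀}}(M) = det(M)^{λ₁} S_μ(M)` and at `σ̄₀` the same in `M̄`, and the Weyl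
representation `S_μ` is polynomial (`isPolynomialRep_weylRep_holds`: every matrix coefficient is a
polynomial in the entries).  Hence every matrix coefficient `M ↦ ℓ(E(M) v)` is `C^∞` on the open set
`Inv = {det ≠ 0}` of the real normed space `M₂(ℂ)` (`contDiffOn_coeffRepC_dual`: polynomials,
complex conjugation and `det^{±1}` are smooth; pure tensors expand in bases, `MultilinearMap.map_sum`),
and so is the vector-valued map in the finite-dimensional `E_λ(ℂ)` (`contDiffOn_coeffRepC`) — the
regularity input for the Eichler–Shimura–Harder cochains `X ↦ (M ↦ E(M) η_X(M, c))` of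
`GL2CEquivariantPrimitive`. [cite: FultonHarrisGTM129, §15.5] [cite: BorelWallach2000, VII §2.2]

Theorems only (and the total extension `toGL` of `M ↦ M` to `GL₂(ℂ)`, the factor matrices
`factorMat`); no named fact.
-/

noncomputable section

open scoped Matrix ComplexConjugate TensorProduct MatrixGroups Topology Matrix.Norms.Operator ContDiff BigOperators
open Complex Filter

namespace Literature.NumberTheory.Automorphic

/-- **Vector-valued smoothness from matrix coefficients** in a finite-dimensional space. [folklore] -/
theorem contDiffOn_of_dual {X : Type*} [NormedAddCommGroup X] [NormedSpace ℝ X]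
    {E : Type*} [NormedAddCommGroup E] [NormedSpace ℂ E] [FiniteDimensional ℂ E]
    {F : X → E} {s : Set X} {n : WithTop ℕ∞}
    (h : ∀ ℓ : Module.Dual ℂ E, ContDiffOn ℝ n (fun M => ℓ (F M)) s) : ContDiffOn ℝ n F s := by
  let b := Module.finBasis ℂ E
  have hF : F = fun M => ∑ i, (b.coord i (F M)) • b i := funext fun M => (b.sum_repr (F M)).symm
  rw [hF]
  exact ContDiffOn.sum fun i _ => (h (b.coord i)).smul contDiffOn_const

namespace GL2CCoeff

open scoped Classical
open _root_.NumberField _root_.NumberField.InfinitePlace _root_.NumberField.mixedEmbedding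
open RealMatrixGroup GLnCohomology ResGLnCohomology ComplexPlace ImaginaryQuadratic GL2C
open Literature.NumberTheory.DiophantineGeometry

/-! ### Smooth scalar functions on `M₂(ℂ)` -/

/-- `M ↦ M` extended to a total map `M₂(ℂ) → GL₂(ℂ)` (junk value `1` off `Inv`). [folklore] -/
def toGL (M : Mat) : GL (Fin 2) ℂ :=
  if h : IsUnit M.det then Matrix.GeneralLinearGroup.mk'' M h else 1

/-- On `Inv`, `toGL M` has underlying matrix `M`. [folklore] -/
theorem coe_toGL {M : Mat} (h : IsUnit M.det) : (toGL M : Mat) = M := by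
  rw [toGL, dif_pos h]; rfl

/-- On `Inv`, `toGL M = mk'' M h`. [folklore] -/
theorem toGL_eq {M : Mat} (h : IsUnit M.det) : toGL M = Matrix.GeneralLinearGroup.mk'' M h := by
  rw [toGL, dif_pos h]

/-- A group element has invertible determinant. [folklore] -/
theorem isUnit_det_coe (g : GL (Fin 2) ℂ) : IsUnit (g : Mat).det := by
  rw [← Matrix.GeneralLinearGroup.val_det_apply]; exact Units.isUnit _

/-- `toGL` of a group element. [folklore] -/
@[simp] theorem toGL_coe (g : GL (Fin 2) ℂ) : toGL (g : Mat) = g :=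
  Units.ext (coe_toGL (isUnit_det_coe g))

/-- Integer powers are smooth away from zero. [folklore] -/
theorem contDiffAt_zpow_of_ne_zero (m : ℤ) {x : ℂ} (hx : x ≠ 0) {n : WithTop ℕ∞} :
    ContDiffAt ℝ n (fun y : ℂ => y ^ m) x := by
  have h : ContDiffAt ℂ n (fun y : ℂ => y ^ m) x := by
    rcases m with k | k
    · simp only [Int.ofNat_eq_natCast, zpow_natCast]
      exact (contDiff_id.pow k).contDiffAt
    · simp only [zpow_negSucc]
      exact (contDiff_id.pow (k + 1)).contDiffAt.inv (pow_ne_zero _ hx)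
  exact h.restrict_scalars ℝ

/-- **Polynomial functions of the entries of a smooth matrix-valued map are smooth.** [folklore] -/
theorem contDiff_eval_entries (P : MvPolynomial (Fin 2 × Fin 2) ℂ) {f : Mat → Mat} {n : WithTop ℕ∞}
    (hf : ContDiff ℝ n f) :
    ContDiff ℝ n (fun M => MvPolynomial.eval (fun ij : Fin 2 × Fin 2 => f M ij.1 ij.2) P) := by
  induction P using MvPolynomial.induction_on with
  | C a => simp only [MvPolynomial.eval_C]; exact contDiff_const
  | add p q hp hq => simp only [map_add]; exact hp.add hq
  | mul_X p ij hp =>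
    simp only [map_mul, MvPolynomial.eval_X]
    exact hp.mul ((contDiff_entry ij.1 ij.2).comp hf)

/-- Entrywise complex conjugation, a real-linear map of `M₂(ℂ)`. [folklore] -/
def conjMatLM : Mat →ₗ[ℝ] Mat where
  toFun M := M.map conj
  map_add' M N := Matrix.map_add (f := (conj : ℂ → ℂ)) (map_add _) M N
  map_smul' r M := Matrix.ext fun i j => by simp

/-- Entrywise conjugation is smooth. [folklore] -/
theorem contDiff_map_conj {n : WithTop ℕ∞} : ContDiff ℝ n (fun M : Mat => M.map conj) :=
  (conjMatLM.toContinuousLinearMap).contDiff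

variable (K : Type) [Field K] [NumberField K] [IsTotallyComplex K] (lam : (K →+* ℂ) → Fin 2 → ℤ)

/-- **The factor matrix at `τ`**: `M` at `σ₀`, `M̄` at `σ̄₀`. [folklore] -/
def factorMat (τ : K →+* ℂ) (M : Mat) : Mat := if τ = placeEmbedding K then M else M.map conj

/-- The factor matrices are smooth in `M`. [folklore] -/
theorem contDiff_factorMat (τ : K →+* ℂ) {n : WithTop ℕ∞} : ContDiff ℝ n (factorMat K τ) := by
  unfold factorMat
  split_ifs
  · exact contDiff_id
  · exact contDiff_map_conj

/-- `τ̃ (embGL M) = factorMat τ M` on `Inv`. [folklore] -/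
theorem coe_map_embGL_toGL (hK : Subsingleton (InfinitePlace K)) (τ : K →+* ℂ) {M : Mat} (h : IsUnit M.det) :
    ((Matrix.GeneralLinearGroup.map (embeddingExt τ : mixedSpace K →+* ℂ)
      ((embGL K (toGL M) : (archGroupGL 2 K).carrier) : GL (Fin 2) (mixedSpace K)) : GL (Fin 2) ℂ) : Mat) =
      factorMat K τ M := by
  ext i j
  rw [Matrix.GeneralLinearGroup.map_apply, coe_embGL, Matrix.GeneralLinearGroup.map_apply, coe_toGL h]
  change embeddingExt τ (ofComplex K (M i j)) = _
  rw [embeddingExt_ofComplex K hK]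
  unfold factorMat
  split_ifs <;> rfl

/-- The factor matrices of an invertible matrix are invertible. [folklore] -/
theorem det_factorMat_ne_zero (τ : K →+* ℂ) {M : Mat} (h : IsUnit M.det) : (factorMat K τ M).det ≠ 0 := by
  unfold factorMat
  split_ifs
  · exact h.ne_zero
  · rw [show M.map conj = (starRingEnd ℂ).mapMatrix M from rfl, ← RingHom.map_det]
    exact (map_ne_zero (starRingEnd ℂ)).2 h.ne_zero

/-! ### Matrix coefficients of the factors -/

/-- **Per factor: `M ↦ φ(V_{λ_τ}(τ̃ M) v)` is smooth on `Inv`** (`det^{λ₁}` times a polynomial in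
the entries of `M` or `M̄`, by `isPolynomialRep_weylRep_holds`). [cite: FultonHarrisGTM129, §15.5] -/
theorem contDiffOn_factorRep_dual (hK : Subsingleton (InfinitePlace K)) (τ : K →+* ℂ)
    (v : GLnCohomology.CoeffModule ℂ 2 (lam τ)) (φ : Module.Dual ℂ (GLnCohomology.CoeffModule ℂ 2 (lam τ)))
    {n : WithTop ℕ∞} :
    ContDiffOn ℝ n (fun M : Mat => φ (ParallelWeight.factorRep K 2 (lam τ) τ (embGL K (toGL M)) v)) Inv := by
  obtain ⟨P, hP⟩ := isPolynomialRep_weylRep_holds ℂ (Fin 2) (coeffPartition (lam τ)) v φ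
  have hformula : ∀ M ∈ GL2C.Inv, φ (ParallelWeight.factorRep K 2 (lam τ) τ (embGL K (toGL M)) v) =
      (factorMat K τ M).det ^ lowestEntry (lam τ) *
        MvPolynomial.eval (fun ij : Fin 2 × Fin 2 => factorMat K τ M ij.1 ij.2) P := by
    intro M hM
    have hg := coe_map_embGL_toGL K hK τ (M := M) hM
    rw [ParallelWeight.factorRep_apply, coeffRepGL_apply, map_smul, smul_eq_mul]
    congr 1
    · rw [Units.val_zpow_eq_zpow_val, Matrix.GeneralLinearGroup.val_det_apply, hg]
    · have := hP (Matrix.GeneralLinearGroup.map (embeddingExt τ : mixedSpace K →+* ℂ)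
        ((embGL K (toGL M) : (archGroupGL 2 K).carrier) : GL (Fin 2) (mixedSpace K)))
      rw [hg] at this
      exact this
  refine ContDiffOn.congr ?_ hformula
  refine ContDiffOn.mul (fun M hM => ?_) ((contDiff_eval_entries P (contDiff_factorMat K τ)).contDiffOn)
  have hdet : ContDiffAt ℝ n (fun M => (factorMat K τ M).det) M :=
    (contDiff_det.comp (contDiff_factorMat K τ)).contDiffAt
  exact ((contDiffAt_zpow_of_ne_zero (lowestEntry (lam τ)) (det_factorMat_ne_zero K τ hM)).comp M hdet).contDiffWithinAt

/-! ### Matrix coefficients of `E_λ(ℂ)` and the vector-valued map -/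

/-- **`M ↦ ℓ(E(M) v)` is smooth on `Inv`** for every `v ∈ E_λ(ℂ)` and every functional `ℓ`.
[cite: FultonHarrisGTM129, §15.5] -/
theorem contDiffOn_coeffRepC_dual (hK : Subsingleton (InfinitePlace K)) (v : ResGLnCohomology.CoeffModule ℂ 2 K lam)
    (ℓ : Module.Dual ℂ (ResGLnCohomology.CoeffModule ℂ 2 K lam)) {n : WithTop ℕ∞} :
    ContDiffOn ℝ n (fun M : Mat => ℓ (coeffRepC K lam (toGL M) v)) Inv := by
  haveI : ∀ τ : K →+* ℂ, FiniteDimensional ℂ (GLnCohomology.CoeffModule ℂ 2 (lam τ)) := fun τ =>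
    ParallelWeight.finiteDimensional_coeffModule 2 (lam τ)
  induction v using ResGLnCohomology.CoeffModule.induction_on generalizing ℓ with
  | smul_tprod c w =>
    simp only [map_smul, smul_eq_mul]
    refine contDiffOn_const.mul ?_
    let b := fun τ : K →+* ℂ => Module.finBasis ℂ (GLnCohomology.CoeffModule ℂ 2 (lam τ))
    have hexp : ∀ M : Mat, ℓ (coeffRepC K lam (toGL M) (CoeffModule.tprod w)) =
        ∑ J : (∀ τ : K →+* ℂ, Fin (Module.finrank ℂ (GLnCohomology.CoeffModule ℂ 2 (lam τ)))),
          (∏ τ, (b τ).coord (J τ) (ParallelWeight.factorRep K 2 (lam τ) τ (embGL K (toGL M)) (w τ))) *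
            ℓ (CoeffModule.tprod fun τ => b τ (J τ)) := by
      intro M
      rw [coeffRepC_apply, ResGLnCohomology.archCoeffRep_apply_tprod]
      have hw : (fun τ => ParallelWeight.factorRep K 2 (lam τ) τ (embGL K (toGL M)) (w τ)) =
          fun τ => ∑ j, ((b τ).coord j (ParallelWeight.factorRep K 2 (lam τ) τ (embGL K (toGL M)) (w τ))) • b τ j :=
        funext fun τ => ((b τ).sum_repr _).symm
      rw [hw]
      change ℓ (PiTensorProduct.tprod ℂ fun τ => ∑ j,
        ((b τ).coord j (ParallelWeight.factorRep K 2 (lam τ) τ (embGL K (toGL M)) (w τ))) • b τ j) = _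
      rw [MultilinearMap.map_sum (PiTensorProduct.tprod ℂ)
        (fun τ j => ((b τ).coord j (ParallelWeight.factorRep K 2 (lam τ) τ (embGL K (toGL M)) (w τ))) • b τ j)]
      change ℓ (∑ r : (∀ τ : K →+* ℂ, Fin (Module.finrank ℂ (GLnCohomology.CoeffModule ℂ 2 (lam τ)))),
        (CoeffModule.tprod fun i => ((b i).coord (r i)
          (ParallelWeight.factorRep K 2 (lam i) i (embGL K (toGL M)) (w i))) • b i (r i) :
          ResGLnCohomology.CoeffModule ℂ 2 K lam)) = _
      rw [map_sum ℓ]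
      refine Finset.sum_congr rfl fun J _ => ?_
      change ℓ (PiTensorProduct.tprod ℂ fun i => ((b i).coord (J i)
          (ParallelWeight.factorRep K 2 (lam i) i (embGL K (toGL M)) (w i))) • b i (J i)) = _
      rw [MultilinearMap.map_smul_univ]
      change ℓ ((∏ i, (b i).coord (J i) (ParallelWeight.factorRep K 2 (lam i) i (embGL K (toGL M)) (w i))) •
        (CoeffModule.tprod (fun i => b i (J i)) : ResGLnCohomology.CoeffModule ℂ 2 K lam)) = _
      rw [map_smul, smul_eq_mul]
    refine ContDiffOn.congr ?_ fun M _ => hexp M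
    refine ContDiffOn.sum fun J _ => ContDiffOn.mul ?_ contDiffOn_const
    exact contDiffOn_prod fun τ _ => contDiffOn_factorRep_dual K lam hK τ (w τ) ((b τ).coord (J τ))
  | add x y hx hy =>
    simp only [map_add]
    exact (hx ℓ).add (hy ℓ)

/-- **`M ↦ E(M) v` is smooth on `Inv`** (vector-valued, `E_λ(ℂ)` finite-dimensional).
[cite: FultonHarrisGTM129, §15.5] [cite: BorelWallach2000, VII §2.2] -/
theorem contDiffOn_coeffRepC (hK : Subsingleton (InfinitePlace K)) (v : ResGLnCohomology.CoeffModule ℂ 2 K lam)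
    {n : WithTop ℕ∞} : ContDiffOn ℝ n (fun M : Mat => coeffRepC K lam (toGL M) v) Inv :=
  contDiffOn_of_dual fun ℓ => contDiffOn_coeffRepC_dual K lam hK v ℓ

/-- The same for any map agreeing with `M ↦ E(M) v` on invertible matrices. [folklore] -/
theorem contDiffOn_of_eq_coeffRepC (hK : Subsingleton (InfinitePlace K)) (v : ResGLnCohomology.CoeffModule ℂ 2 K lam)
    {F : Mat → ResGLnCohomology.CoeffModule ℂ 2 K lam}
    (hF : ∀ (M : Mat) (h : IsUnit M.det), F M = coeffRepC K lam (Matrix.GeneralLinearGroup.mk'' M h) v)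
    {n : WithTop ℕ∞} : ContDiffOn ℝ n F Inv :=
  (contDiffOn_coeffRepC K lam hK v).congr fun M hM => by rw [hF M hM, toGL_eq hM]

end GL2CCoeff

end Literature.NumberTheory.Automorphic

end
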